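/-
Copyright (c) 2026. All rights reserved.
Released under Apache 2.0 license as described in the file LICENSE.
Authors: abc-iut cell, seat abc-iut-L4-t15 (gen 6).
-/
import Literature.GroupTheory.BoundedCommutatorWidthPByMetacyclic
import Literature.GroupTheory.ProPPowerMap
import Literature.GroupTheory.ProfiniteClosureFiniteWidth
import Mathlib.Topology.Algebra.OpenSubgroup
import Mathlib.Data.List.FinRange

/-!
# Closedness of `⁅H, G⁆ · Hⁿ` in profinite groups of `p`-by-metacyclic shape (N–S-free)

Let `G` be a profinite group (compact, Hausdorff, totally disconnected topological group) with a
closed normal subgroup `P` that is pro-`p` (`x ^ p ^ k → 1` for `x ∈ P`), elements `t, s ∈ G` and a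
slot tuple `g : Fin d → G` such that

* `(S1)` for every open normal `W`, `t ^ e ∈ P·W` for some `e` coprime to `p`
  ("the image of `t` modulo `P` is pro-`p'`");
* `(S2)` every conjugate of `t` lies in the closure of `⟨t⟩P`, and every `w s w⁻¹ s⁻¹` does too
  ("`C = cl(⟨t⟩P)` is normal with `G/C` generated by `s`");
* `(S3)` the slots topologically generate `G`, each slot lies in `P` or equals `t` or `s`, `t` and `s`
  occur among the slots, and `P` is the closed normal subgroup generated by the slots lying in `P`.

This is the shape of the absolute Galois group of a `p`-adic field (wild inertia `P`, tame generator
`t`, Frobenius `s`, `P` normally generated by finitely many elements) — these structural inputs are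
classical and are NOT proved here.  For every closed normal `H ≤ P` and every `n` we prove:

* `exists_pow_mul_prod_commutator_of_profinite` — every element of the ABSTRACT subgroup
  `⁅H, G⁆ ⊔ ⟨xⁿ : x ∈ H⟩` equals `yⁿ · ∏_{j<d} ⁅y_j, g_j⁆` with `y, y_j ∈ H` (bounded width holds in every
  finite quotient `G/W` by `Literature/GroupTheory/BoundedCommutatorWidthPByMetacyclic.lean`, and the
  set of such words is compact);
* `isClosed_commutator_sup_pow_of_profinite` — hence `⁅H, G⁆ ⊔ ⟨xⁿ : x ∈ H⟩` is CLOSED;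
* `exists_prod_commutator_of_profinite`, `isClosed_commutator_of_profinite` — the case `n = 0`:
  `⁅H, G⁆ = ⁅H, g_0⁆ ⋯ ⁅H, g_{d-1}⁆` is closed.

This is the closedness half `(d')` of hypothesis `(c'')` of
`Literature.GroupTheory.isOpen_of_finiteIndex_of_proP_normal` (`StronglyCompleteWildReduction.lean`,
seat abc-iut-w5-d006) — the part that is "of Nikolov–Segal type" — obtained WITHOUT the theorem of
Nikolov–Segal (Ann. of Math. 165 (2007)); the openness half `(c)` (finiteness of the `G`-coinvariants of
`H`) is not addressed here.  Mathlib-only vocabulary, no definitions, no instances (cell abc-iut,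
GAP-LEDGER G-L3d2g2-1; F-1977 / F-0412 neighbourhood).
-/

namespace Literature.GroupTheory

open scoped commutatorElement Pointwise

universe u

variable {G : Type u} [Group G] [TopologicalSpace G] [IsTopologicalGroup G] [CompactSpace G]
  [T2Space G] [TotallyDisconnectedSpace G]

/-! ### The main profinite statement -/

/-- **Bounded width with `n`-th powers, profinite form (N–S-free).**  In the setting of the module
docstring, for every closed normal subgroup `H ≤ P` and every `n`, every element of the abstract
subgroup `⁅H, G⁆ ⊔ ⟨xⁿ : x ∈ H⟩` is of the form `yⁿ · ∏_{j<d} ⁅y_j, g_j⁆` with `y, y_j ∈ H`.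
[cite: NikolovSegal2007, Theorem 1.2] -/
theorem exists_pow_mul_prod_commutator_of_profinite {p : ℕ} [Fact p.Prime] (P : Subgroup G)
    [hPn : P.Normal] (hPp : ∀ x ∈ P, ∀ U ∈ nhds (1 : G), ∃ k : ℕ, x ^ p ^ k ∈ U) (t s : G)
    (hte : ∀ W : OpenNormalSubgroup G, ∃ e : ℕ, p.Coprime e ∧ t ^ e ∈ (P ⊔ (W : Subgroup G)))
    (ht_conj : ∀ w : G, w * t * w⁻¹ ∈ closure ((Subgroup.zpowers t ⊔ P : Subgroup G) : Set G))
    (hs_conj : ∀ w : G, w * s * w⁻¹ * s⁻¹ ∈ closure ((Subgroup.zpowers t ⊔ P : Subgroup G) : Set G))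
    {d : ℕ} (g : Fin d → G) (hgen : Dense ((Subgroup.closure (Set.range g) : Subgroup G) : Set G))
    (hslots : ∀ j, g j ∈ P ∨ g j = t ∨ g j = s) (jt js : Fin d) (hjt : g jt = t) (hjs : g js = s)
    (hPgen : (P : Set G) ⊆
      closure ((Subgroup.normalClosure {x | x ∈ Set.range g ∧ x ∈ P} : Subgroup G) : Set G))
    (H : Subgroup G) [hHn : H.Normal] (hHc : IsClosed (H : Set G)) (hHP : H ≤ P) (n : ℕ) {a : G}
    (ha : a ∈ ⁅H, (⊤ : Subgroup G)⁆ ⊔ Subgroup.closure {y | ∃ x ∈ H, x ^ n = y}) :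
    ∃ y ∈ H, ∃ v : Fin d → G, (∀ j, v j ∈ H) ∧
      a = y ^ n * (List.ofFn fun j => ⁅v j, g j⁆).prod := by
  classical
  -- the compact set of words `yⁿ Φ_g(v)`
  let F : H × (Fin d → H) → G := fun q => (q.1 : G) ^ n * (List.ofFn fun j => ⁅(q.2 j : G), g j⁆).prod
  have hFc : Continuous F := by
    apply Continuous.mul
    · exact (continuous_subtype_val.comp continuous_fst).pow n
    · have : (fun q : H × (Fin d → H) => (List.ofFn fun j => ⁅(q.2 j : G), g j⁆).prod) =
          fun q => ((List.finRange d).map fun j => ⁅(q.2 j : G), g j⁆).prod := by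
        funext q; rw [List.ofFn_eq_map]
      rw [this]
      refine continuous_list_prod _ fun j _ => ?_
      simp only [commutatorElement_def]
      have hc : Continuous fun q : H × (Fin d → H) => ((q.2 j : H) : G) :=
        continuous_subtype_val.comp ((continuous_apply j).comp continuous_snd)
      exact ((hc.mul continuous_const).mul hc.inv).mul continuous_const
  haveI : CompactSpace H := isCompact_iff_compactSpace.mp hHc.isCompact
  let X : Set G := Set.range F
  have hXc : IsClosed X := (isCompact_range hFc).isClosed
  -- `a ∈ X`: check modulo every open normal subgroup `W`
  suffices haX : a ∈ X by
    obtain ⟨⟨y, v⟩, rfl⟩ := haX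
    exact ⟨y, y.2, fun j => (v j : G), fun j => (v j).2, rfl⟩
  refine mem_of_forall_mem_mul_openNormalSubgroup hXc fun W => ?_
  -- the finite quotient `G ⧸ W` and the transported setting
  let Wg : Subgroup G := (W : Subgroup G)
  haveI : Wg.Normal := W.isNormal'
  haveI : Finite (G ⧸ Wg) := Subgroup.quotient_finite_of_isOpen Wg W.isOpen
  let mk := QuotientGroup.mk' Wg
  have hsurj : Function.Surjective mk := QuotientGroup.mk'_surjective Wg
  have hkerW : ∀ w ∈ Wg, mk w = 1 := fun w hw => by
    rw [QuotientGroup.mk'_apply, QuotientGroup.eq_one_iff]; exact hw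
  haveI hPbar : (P.map mk).Normal := hPn.map mk hsurj
  haveI hHbar : (H.map mk).Normal := hHn.map mk hsurj
  have hPp' : IsPGroup p (P.map mk) := by
    rintro ⟨_, x, hx, rfl⟩
    obtain ⟨k, hk⟩ := hPp x hx Wg (W.isOpen.mem_nhds W.one_mem)
    exact ⟨k, Subtype.ext (by
      change mk x ^ p ^ k = 1
      rw [← map_pow]; exact hkerW _ hk)⟩
  obtain ⟨e, hpe, hteW⟩ := hte W
  have hte' : (mk t) ^ e ∈ P.map mk := by
    rw [← map_pow]
    have : mk (t ^ e) ∈ (P ⊔ Wg).map mk := Subgroup.mem_map_of_mem _ hteW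
    rw [Subgroup.map_sup] at this
    have hWbot : Wg.map mk = ⊥ := by
      rw [Subgroup.map_eq_bot_iff, QuotientGroup.ker_mk']
    rwa [hWbot, sup_bot_eq] at this
  -- images of elements of `cl(⟨t⟩P)` are `t̄ ^ a * ȳ`
  have himg : ∀ z : G, z ∈ closure ((Subgroup.zpowers t ⊔ P : Subgroup G) : Set G) →
      ∃ a : ℕ, ∃ y ∈ P.map mk, mk z = (mk t) ^ a * y := by
    intro z hz
    obtain ⟨c, hc, w, hw, rfl⟩ := Set.mem_mul.mp (closure_subset_mul_of_isOpen _ Wg W.isOpen hz)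
    have hc' : c ∈ ((Subgroup.zpowers t ⊔ P : Subgroup G) : Set G) := hc
    rw [Subgroup.mul_normal] at hc'
    obtain ⟨c₁, hc₁, y, hy, rfl⟩ := Set.mem_mul.mp hc'
    have hc₁' : mk c₁ ∈ Subgroup.zpowers (mk t) := by
      rw [← MonoidHom.map_zpowers]; exact Subgroup.mem_map_of_mem _ hc₁
    rw [mem_zpowers_iff_mem_range_orderOf] at hc₁'
    obtain ⟨i, -, hi⟩ := Finset.mem_image.mp hc₁'
    refine ⟨i, mk y, Subgroup.mem_map_of_mem _ hy, ?_⟩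
    rw [map_mul, map_mul, hkerW w hw, mul_one, ← hi]
  have ht_conj' : ∀ w : G ⧸ Wg, ∃ a : ℕ, ∃ y ∈ P.map mk, w * mk t * w⁻¹ = (mk t) ^ a * y := by
    intro w
    obtain ⟨w, rfl⟩ := hsurj w
    obtain ⟨a, y, hy, h⟩ := himg _ (ht_conj w)
    exact ⟨a, y, hy, by rw [← h, map_mul, map_mul, map_inv]⟩
  have hs_conj' : ∀ w : G ⧸ Wg, ∃ a : ℕ, ∃ y ∈ P.map mk,
      w * mk s * w⁻¹ = (mk t) ^ a * mk s * y := by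
    intro w
    obtain ⟨w, rfl⟩ := hsurj w
    obtain ⟨a, y, hy, h⟩ := himg _ (hs_conj w)
    refine ⟨a, (mk s)⁻¹ * y * mk s, hPbar.conj_mem' _ hy _, ?_⟩
    have : mk w * mk s * (mk w)⁻¹ = mk (w * s * w⁻¹ * s⁻¹) * mk s := by
      rw [map_mul, map_mul, map_mul, map_inv, map_inv]; group
    rw [this, h]; group
  have hgen' : Subgroup.closure (Set.range (fun j => mk (g j))) = ⊤ := by
    rw [eq_top_iff]
    intro q _
    obtain ⟨x, rfl⟩ := hsurj q
    have hx : x ∈ closure ((Subgroup.closure (Set.range g) : Subgroup G) : Set G) := hgen x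
    obtain ⟨c, hc, w, hw, rfl⟩ := Set.mem_mul.mp (closure_subset_mul_of_isOpen _ Wg W.isOpen hx)
    rw [map_mul, hkerW w hw, mul_one, Set.range_comp', ← MonoidHom.map_closure]
    exact Subgroup.mem_map_of_mem _ hc
  have hslots' : ∀ j, mk (g j) ∈ P.map mk ∨ mk (g j) = mk t ∨ mk (g j) = mk s := by
    intro j
    rcases hslots j with h | h | h
    · exact Or.inl (Subgroup.mem_map_of_mem _ h)
    · exact Or.inr (Or.inl (by rw [h]))
    · exact Or.inr (Or.inr (by rw [h]))
  have hPgen' : P.map mk ≤ Subgroup.normalClosure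
      {x | x ∈ Set.range (fun j => mk (g j)) ∧ x ∈ P.map mk} := by
    rintro _ ⟨x, hx, rfl⟩
    obtain ⟨c, hc, w, hw, rfl⟩ :=
      Set.mem_mul.mp (closure_subset_mul_of_isOpen _ Wg W.isOpen (hPgen hx))
    rw [map_mul, hkerW w hw, mul_one]
    have h1 : mk c ∈ (Subgroup.normalClosure {x | x ∈ Set.range g ∧ x ∈ P}).map mk :=
      Subgroup.mem_map_of_mem _ hc
    refine (Subgroup.map_normalClosure_le _ _).trans (Subgroup.normalClosure_mono ?_) h1
    rintro _ ⟨z, ⟨⟨j, rfl⟩, hz⟩, rfl⟩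
    exact ⟨⟨j, rfl⟩, Subgroup.mem_map_of_mem _ hz⟩
  have hHP' : H.map mk ≤ P.map mk := Subgroup.map_mono hHP
  -- the image of `a`
  have ha' : mk a ∈ ⁅H.map mk, (⊤ : Subgroup (G ⧸ Wg))⁆ ⊔
      Subgroup.closure {y | ∃ x ∈ H.map mk, x ^ n = y} := by
    have h1 : mk a ∈ (⁅H, (⊤ : Subgroup G)⁆ ⊔ Subgroup.closure {y | ∃ x ∈ H, x ^ n = y}).map mk :=
      Subgroup.mem_map_of_mem _ ha
    rw [Subgroup.map_sup, Subgroup.map_commutator, Subgroup.map_top_of_surjective _ hsurj,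
      MonoidHom.map_closure] at h1
    refine (sup_le_sup_left (Subgroup.closure_mono ?_) _) h1
    rintro _ ⟨y, ⟨x, hx, rfl⟩, rfl⟩
    exact ⟨mk x, Subgroup.mem_map_of_mem _ hx, by rw [map_pow]⟩
  obtain ⟨ybar, hybar, vbar, hvbar, hav⟩ := exists_pow_mul_prod_commutator_of_mem_sup (P.map mk)
    hPp' (mk t) (mk s) hte' hpe ht_conj' hs_conj' (fun j => mk (g j)) hgen' hslots' jt js
    (by rw [hjt]) (by rw [hjs]) hPgen' (H.map mk) hHP' n ha'
  -- lift `ybar`, `vbar` to `H`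
  obtain ⟨y, hyH, rfl⟩ := Subgroup.mem_map.mp hybar
  have hlift : ∀ j, ∃ z : G, z ∈ H ∧ mk z = vbar j := fun j => Subgroup.mem_map.mp (hvbar j)
  choose v hvH hv using hlift
  -- `a ∈ F (y, v) * W`
  refine Set.mem_mul.mpr ⟨F (⟨y, hyH⟩, fun j => ⟨v j, hvH j⟩), ⟨_, rfl⟩,
    (F (⟨y, hyH⟩, fun j => ⟨v j, hvH j⟩))⁻¹ * a, ?_, by group⟩
  change _ ∈ Wg
  rw [← QuotientGroup.eq, ← QuotientGroup.mk'_apply, ← QuotientGroup.mk'_apply]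
  change mk (y ^ n * (List.ofFn fun j => ⁅v j, g j⁆).prod) = mk a
  rw [hav, map_mul, map_pow, map_list_prod, List.map_ofFn]
  congr 1
  exact congrArg (fun f : Fin d → G ⧸ Wg => (List.ofFn f).prod)
    (funext fun j => by simp [map_commutatorElement, hv])

/-- **Closedness of `⁅H, G⁆ · Hⁿ` (N–S-free).**  In the setting of the module docstring, for every closed
normal `H ≤ P` and every `n` the abstract subgroup `⁅H, G⁆ ⊔ ⟨xⁿ : x ∈ H⟩` is closed: it is the compact set
of words `yⁿ ∏_{j<d} ⁅y_j, g_j⁆` (`y, y_j ∈ H`).  This is the "Nikolov–Segal-type" half `(d')` of hypothesis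
`(c'')` of `Literature.GroupTheory.isOpen_of_finiteIndex_of_proP_normal`, for this class of groups,
without the Nikolov–Segal theorem. [cite: NikolovSegal2007, Theorem 1.4] -/
theorem isClosed_commutator_sup_pow_of_profinite {p : ℕ} [Fact p.Prime] (P : Subgroup G)
    [hPn : P.Normal] (hPp : ∀ x ∈ P, ∀ U ∈ nhds (1 : G), ∃ k : ℕ, x ^ p ^ k ∈ U) (t s : G)
    (hte : ∀ W : OpenNormalSubgroup G, ∃ e : ℕ, p.Coprime e ∧ t ^ e ∈ (P ⊔ (W : Subgroup G)))
    (ht_conj : ∀ w : G, w * t * w⁻¹ ∈ closure ((Subgroup.zpowers t ⊔ P : Subgroup G) : Set G))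
    (hs_conj : ∀ w : G, w * s * w⁻¹ * s⁻¹ ∈ closure ((Subgroup.zpowers t ⊔ P : Subgroup G) : Set G))
    {d : ℕ} (g : Fin d → G) (hgen : Dense ((Subgroup.closure (Set.range g) : Subgroup G) : Set G))
    (hslots : ∀ j, g j ∈ P ∨ g j = t ∨ g j = s) (jt js : Fin d) (hjt : g jt = t) (hjs : g js = s)
    (hPgen : (P : Set G) ⊆
      closure ((Subgroup.normalClosure {x | x ∈ Set.range g ∧ x ∈ P} : Subgroup G) : Set G))
    (H : Subgroup G) [hHn : H.Normal] (hHc : IsClosed (H : Set G)) (hHP : H ≤ P) (n : ℕ) :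
    IsClosed ((⁅H, (⊤ : Subgroup G)⁆ ⊔ Subgroup.closure {y | ∃ x ∈ H, x ^ n = y} : Subgroup G) :
      Set G) := by
  classical
  let F : H × (Fin d → H) → G := fun q => (q.1 : G) ^ n * (List.ofFn fun j => ⁅(q.2 j : G), g j⁆).prod
  have hFc : Continuous F := by
    apply Continuous.mul
    · exact (continuous_subtype_val.comp continuous_fst).pow n
    · have : (fun q : H × (Fin d → H) => (List.ofFn fun j => ⁅(q.2 j : G), g j⁆).prod) =
          fun q => ((List.finRange d).map fun j => ⁅(q.2 j : G), g j⁆).prod := by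
        funext q; rw [List.ofFn_eq_map]
      rw [this]
      refine continuous_list_prod _ fun j _ => ?_
      simp only [commutatorElement_def]
      have hc : Continuous fun q : H × (Fin d → H) => ((q.2 j : H) : G) :=
        continuous_subtype_val.comp ((continuous_apply j).comp continuous_snd)
      exact ((hc.mul continuous_const).mul hc.inv).mul continuous_const
  haveI : CompactSpace H := isCompact_iff_compactSpace.mp hHc.isCompact
  -- the subgroup equals the compact set `range F`
  suffices heq : ((⁅H, (⊤ : Subgroup G)⁆ ⊔ Subgroup.closure {y | ∃ x ∈ H, x ^ n = y} : Subgroup G) :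
      Set G) = Set.range F by
    rw [heq]; exact (isCompact_range hFc).isClosed
  ext a
  constructor
  · intro ha
    obtain ⟨y, hy, v, hv, rfl⟩ := exists_pow_mul_prod_commutator_of_profinite P hPp t s hte ht_conj
      hs_conj g hgen hslots jt js hjt hjs hPgen H hHc hHP n ha
    exact ⟨(⟨y, hy⟩, fun j => ⟨v j, hv j⟩), rfl⟩
  · rintro ⟨⟨y, v⟩, rfl⟩
    refine Subgroup.mul_mem _ (Subgroup.mem_sup_right (Subgroup.subset_closure ⟨y, y.2, rfl⟩))
      (Subgroup.mem_sup_left (list_prod_mem fun z hz => ?_))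
    rw [List.mem_ofFn] at hz
    obtain ⟨j, rfl⟩ := hz
    exact Subgroup.commutator_mem_commutator (v j).2 (Subgroup.mem_top _)

/-- **Bounded commutator width, profinite form (N–S-free).**  In the setting of the module docstring,
for every closed normal `H ≤ P`: `⁅H, G⁆ = ⁅H, g_0⁆ ⋯ ⁅H, g_{d-1}⁆` as a product of sets — every
element of the abstract commutator subgroup `⁅H, G⁆` is `∏_{j<d} ⁅y_j, g_j⁆` with `y_j ∈ H`.
[cite: NikolovSegal2007, Theorem 1.2] -/
theorem exists_prod_commutator_of_profinite {p : ℕ} [Fact p.Prime] (P : Subgroup G)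
    [hPn : P.Normal] (hPp : ∀ x ∈ P, ∀ U ∈ nhds (1 : G), ∃ k : ℕ, x ^ p ^ k ∈ U) (t s : G)
    (hte : ∀ W : OpenNormalSubgroup G, ∃ e : ℕ, p.Coprime e ∧ t ^ e ∈ (P ⊔ (W : Subgroup G)))
    (ht_conj : ∀ w : G, w * t * w⁻¹ ∈ closure ((Subgroup.zpowers t ⊔ P : Subgroup G) : Set G))
    (hs_conj : ∀ w : G, w * s * w⁻¹ * s⁻¹ ∈ closure ((Subgroup.zpowers t ⊔ P : Subgroup G) : Set G))
    {d : ℕ} (g : Fin d → G) (hgen : Dense ((Subgroup.closure (Set.range g) : Subgroup G) : Set G))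
    (hslots : ∀ j, g j ∈ P ∨ g j = t ∨ g j = s) (jt js : Fin d) (hjt : g jt = t) (hjs : g js = s)
    (hPgen : (P : Set G) ⊆
      closure ((Subgroup.normalClosure {x | x ∈ Set.range g ∧ x ∈ P} : Subgroup G) : Set G))
    (H : Subgroup G) [hHn : H.Normal] (hHc : IsClosed (H : Set G)) (hHP : H ≤ P) {h : G}
    (hh : h ∈ ⁅H, (⊤ : Subgroup G)⁆) :
    ∃ v : Fin d → G, (∀ j, v j ∈ H) ∧ h = (List.ofFn fun j => ⁅v j, g j⁆).prod := by
  have hh' : h ∈ ⁅H, (⊤ : Subgroup G)⁆ ⊔ Subgroup.closure {y | ∃ x ∈ H, x ^ 0 = y} :=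
    Subgroup.mem_sup_left hh
  obtain ⟨y, -, v, hv, rfl⟩ := exists_pow_mul_prod_commutator_of_profinite P hPp t s hte ht_conj
    hs_conj g hgen hslots jt js hjt hjs hPgen H hHc hHP 0 hh'
  exact ⟨v, hv, by simp⟩

/-- **`⁅H, G⁆` is closed (N–S-free), profinite `p`-by-metacyclic setting.**  For every closed normal
`H ≤ P`, the abstract commutator subgroup `⁅H, G⁆` is closed.  (Nikolov–Segal prove this for every
closed normal subgroup of any topologically finitely generated profinite group, Ann. of Math. 165
(2007), Thm 1.4; here it is obtained by elementary means for the stated class.)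
[cite: NikolovSegal2007, Theorem 1.4] -/
theorem isClosed_commutator_of_profinite {p : ℕ} [Fact p.Prime] (P : Subgroup G)
    [hPn : P.Normal] (hPp : ∀ x ∈ P, ∀ U ∈ nhds (1 : G), ∃ k : ℕ, x ^ p ^ k ∈ U) (t s : G)
    (hte : ∀ W : OpenNormalSubgroup G, ∃ e : ℕ, p.Coprime e ∧ t ^ e ∈ (P ⊔ (W : Subgroup G)))
    (ht_conj : ∀ w : G, w * t * w⁻¹ ∈ closure ((Subgroup.zpowers t ⊔ P : Subgroup G) : Set G))
    (hs_conj : ∀ w : G, w * s * w⁻¹ * s⁻¹ ∈ closure ((Subgroup.zpowers t ⊔ P : Subgroup G) : Set G))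
    {d : ℕ} (g : Fin d → G) (hgen : Dense ((Subgroup.closure (Set.range g) : Subgroup G) : Set G))
    (hslots : ∀ j, g j ∈ P ∨ g j = t ∨ g j = s) (jt js : Fin d) (hjt : g jt = t) (hjs : g js = s)
    (hPgen : (P : Set G) ⊆
      closure ((Subgroup.normalClosure {x | x ∈ Set.range g ∧ x ∈ P} : Subgroup G) : Set G))
    (H : Subgroup G) [hHn : H.Normal] (hHc : IsClosed (H : Set G)) (hHP : H ≤ P) :
    IsClosed ((⁅H, (⊤ : Subgroup G)⁆ : Subgroup G) : Set G) := by
  have h := isClosed_commutator_sup_pow_of_profinite P hPp t s hte ht_conj hs_conj g hgen hslots jt js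
    hjt hjs hPgen H hHc hHP 0
  have hbot : Subgroup.closure {y | ∃ x ∈ H, x ^ 0 = y} = ⊥ := by
    rw [Subgroup.closure_eq_bot_iff]
    rintro _ ⟨x, -, rfl⟩
    simp
  rwa [hbot, sup_bot_eq] at h

end Literature.GroupTheory
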